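import Literature.AlgebraicGeometry.Motives.JacobianThetaPairingOfCurveIso
import Literature.AlgebraicGeometry.Motives.JacobianGaloisCoverNorm
import Literature.AlgebraicGeometry.Motives.AbelianVarietyLevelAdjointCalculus
import Literature.AlgebraicGeometry.Motives.AbelianVarietyWeilPairingAlongIsogeny
import Literature.AlgebraicGeometry.Motives.AlgPointsMapSurjectiveAlgClosed
import Literature.AlgebraicGeometry.Motives.AbelianVarietySimpleOfIsogenyAnyField
import HarnessLib

/-!
# `p^*` is the Weil-pairing adjoint of `Nm_p` **iff** (`(p^*)^*Θ_X ≡ |Δ|·Θ_Y` on pairings) **and** (Aut `X` preserves the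
# canonical pairing of `J_X`): the named fact (F-P2) split into its two classical halves, in the kernel

Layer `Literature/AlgebraicGeometry/Motives`, namespaces `Literature.AlgebraicGeometry.Motives.AbelianVariety` (§1) and
`Literature.AlgebraicGeometry.Motives.Jacobian` (§2–§4).  KERNEL ONLY: theorems; no definition, no named fact, no instance,
no `sorry`.  Nothing analytic.

## The mathematics

Let `p : X → Y = X/Δ` be a Galois cover of smooth projective complex curves, `Nm = Nm_p : J_X → J_Y` the norm,
`t : J_Y → J_X` the homomorphism pinned by `t ∘ Nm = Σ_{δ ∈ Δ} δ_*` (= `p^*`, [LangeRodriguez2022] Prop. 3.5.1), `d = |Δ|`,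
and `ē_X = ē_N^{Θ_X}`, `ē_Y = ē_N^{Θ_Y}` the level pairings of the canonical principal polarisations.  The named fact
★ `Jacobian.galoisCover_pullback_isWeilPairingAdjoint_norm` (F-P2, [LangeRodriguez2022] (3.3) «`\widehat{f^*} = Nm_f`»,
[Lange2023AbelianVarietiesComplex] (4.9)) asserts **(A) `ē_X(t P, Q) = ē_Y(P, Nm Q)`**.  Two classical statements sit inside it:

* **(C) `ē_X(t P, t Q) = ē_Y(P, Q)^d`** — «`(f^*)^*Θ̃ ≡ d·Θ`» read on `N`-torsion points ([BirkenhakeLange2004] §12.3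
  Lemma 12.3.1; [LangeRodriguez2022] Prop. 3.2.1 (a); [Lange2023AbelianVarietiesComplex] §5.3.2 Lemma 5.3.7);
* **(D) `ē_X(δ_* P, δ_* Q) = ē_X(P, Q)`** for `δ ∈ Aut X` — an automorphism of the curve induces an automorphism of the
  canonically polarised Jacobian (the polarisation is the intersection form of `H₁(X, ℤ)`, [Lange2023AbelianVarietiesComplex]
  §4.1.2 Prop. 4.1.2; the trivial direction of Torelli's theorem, [BirkenhakeLange2004] §11.12).

(A) ⇒ (C): `ē_X(tP, tQ) = ē_Y(P, Nm t Q) = ē_Y(P, Q^d)` by ★ `Jacobian.comp_pushforward_eq_card_zsmul` («`Nm_f ∘ f^* = d`»).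
(A) ⇒ (D): ★ `Jacobian.weilPairingLevel_pushforward_iso_eq` (the fact at `Δ = 1`).  **(C) ∧ (D) ⇒ (A)** is the content of
this file (§1): since `δ_* t = t` (both sides solve the pin after `Nm`, which is right-cancellable, ★ `eq_of_pushforward_comp_eq`),
for a `d`-th root `Q′` of `Q` one has `Q = Q′^d = t(Nm Q′) · R` with `R = Q′^d · (∏_δ δ_* Q′)⁻¹`, and by (D) and `δ_* tP̃ = tP̃`,
`ē_X(t P̃, δ_* Q′) = ē_X(t P̃, Q′)` for every `δ`, so `ē_X(t P̃, R) = 1` EXACTLY (no `d`-torsion ambiguity) — the isotypic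
splitting «`Δ`-fixed part ⟂ kernel of `Σ δ_*`» of a `Δ`-invariant alternating form; then (C) at the level `dN`
(`P̃^d = P`) and Lang's change of level ★ `weilPairingLevel_level_mul` (`ē_{dN}(a, b) = ē_N(a^d, b)`) give (A) at level `N`.

## What is proved

* §1 `AbelianVariety.weilPairingLevel_map_eq_map_of_norm_pin` — the GENERIC lemma over any field: abelian varieties `A`,
  `B`, divisors `Θ_A`, `Θ_B`, homomorphisms `Nm : A → B`, `t : B → A`, a finite family `u : Δ → End A` with
  `Nm ≫ t = Σ u_δ`, `t ≫ u_δ = t`, `d`-divisible point groups, (C) and (D) at level `dN` ⟹ (A) at level `N`.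
* §2 `Jacobian.pushforward_act_pullback_eq` — `t ≫ δ_* = t` for the pinned `t` of a Galois cover (any field, a rational point on `X`).
* §3 `Jacobian.weilPairingLevel_pullback_norm_adjoint_of_pullback_pow_of_aut` — (C) ∧ (D) ⇒ (A) for one Galois cover of
  complex curves, binders as in the fact; `Jacobian.weilPairingLevel_map_pullback_eq_pow_card` — (A) ⇒ (C).
* §4 **`Jacobian.galoisCover_pullback_isWeilPairingAdjoint_norm_iff`** — `(F-P2) ↔ (C-statement ∧ D-statement)`, the two
  right-hand statements spelled out in full (no new `def`): (C-statement) = the fact's binders with conclusion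
  `ē_X(tP, tQ) = ē_Y(P, Q)^{|Δ|}`; (D-statement) = for a smooth projective complex curve `X` with `dim J_X ≥ 1`, a
  principal Riemann theta divisor `Θ` and `e : X ≅ X`, `ē^Θ(Nm_e P, Nm_e Q) = ē^Θ(P, Q)`.

Use (cell `hodgecm-mathlib`, D-0151; crux HLiu418 = stmt-HodgeConjecture-24832, d6 line, `stub_RosH` road (P)): the
interface row VI-8 (F-P2) is thereby, in the kernel, EQUIVALENT to the conjunction of two print-shaped classical rows
(C) = [BirkenhakeLange2004, Lemma 12.3.1] and (D) = Aut-invariance of the canonical polarisation; a future in-tree proof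
of VI-8 may deliver the two halves separately.  COUNT-NEUTRAL: nothing here proves (C) or (D).  HC_CM is proved only
modulo the 7 printed citations until rung 0 closes; this file moves no book by itself.

## References
* [LangeRodriguez2022] H. Lange, R. E. Rodríguez, *Decomposition of Jacobians by Prym Varieties*, LNM 2310 (2022), §3.2.1
  eq. (3.3), Prop. 3.2.1 (a) (pp. 46–47); §3.5.1 Prop. 3.5.1, Cor. 3.5.2 (p. 65).
* [BirkenhakeLange2004] C. Birkenhake, H. Lange, *Complex Abelian Varieties*, 2nd ed. (2004), §12.3 Lemma 12.3.1 (p. 372),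
  §11.4 eq. (2) (p. 331), §5.1 (the Rosati involution and `φ_L`).
* [Lange2023AbelianVarietiesComplex] H. Lange, *Abelian Varieties over the Complex Numbers* (2023), §4.1.2 Prop. 4.1.2,
  §4.5.2 eq. (4.9), §5.3.2 Lemma 5.3.7.
* [Lang1983AbelianVarieties] S. Lang, *Abelian Varieties* (1983), Ch. VII §2 Prop. 3 (bilinearity), Prop. 5 (change of level).
* [MumfordAV1970] D. Mumford, *Abelian Varieties* (1970), §20 property (3) of `e_n` (p. 186).
-/

set_option autoImplicit false

noncomputable section

open CategoryTheory AlgebraicGeometry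

universe u v

namespace Literature.AlgebraicGeometry.Motives

namespace AbelianVariety

variable {K : Type u} [Field K] {A B : AbelianVariety K}

/-! ## §1 The generic lemma: (C) ∧ (D) at level `dN` ⟹ (A) at level `N` -/

section NormPin

variable (ΘA : CartierDivisor A.X.left) (ΘB : CartierDivisor B.X.left) (Nm : A ⟶ B) (t : B ⟶ A)
  {Δ : Type v} [Fintype Δ] (u : Δ → (A ⟶ A)) {d N : ℕ}
  [IsDominant (Hom.toSchemeHom ((N : ℤ) • 𝟙 A))] [IsDominant (Hom.toSchemeHom ((N : ℤ) • 𝟙 B))]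
  [IsDominant (Hom.toSchemeHom ((d : ℤ) • 𝟙 A))] [IsDominant (Hom.toSchemeHom ((d : ℤ) • 𝟙 B))]
  [IsDominant (Hom.toSchemeHom (((d * N : ℕ) : ℤ) • 𝟙 A))] [IsDominant (Hom.toSchemeHom (((d * N : ℕ) : ℤ) • 𝟙 B))]

/-- `ē(P, ∏ᵢ Qᵢ) = ∏ᵢ ē(P, Qᵢ)` (multiplicativity in the second variable over a finite product).
[cite: Lang1983AbelianVarieties, Ch. VII §2 Prop. 3] -/
theorem weilPairingLevel_prod_right {M : ℕ} [IsDominant (Hom.toSchemeHom ((M : ℤ) • 𝟙 A))] (Θ : CartierDivisor A.X.left)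
    (P : A.torsionPoints K M) {ι : Type*} (s : Finset ι) (Q : ι → A.torsionPoints K M) :
    A.weilPairingLevel Θ P (∏ i ∈ s, Q i) = ∏ i ∈ s, A.weilPairingLevel Θ P (Q i) := by
  classical
  induction s using Finset.induction_on with
  | empty => rw [Finset.prod_empty, Finset.prod_empty, weilPairingLevel_one_right]
  | insert a s ha ih => rw [Finset.prod_insert ha, Finset.prod_insert ha, weilPairingLevel_mul_right, ih]

/-- **(C) ∧ (D) ⟹ (A), generic form.**  Let `Nm : A → B`, `t : B → A` be homomorphisms of abelian varieties over a field `K`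
and `u : Δ → End A` a finite family with `t ∘ Nm = Σ_δ u_δ` («`Nm_G = f^* ∘ Nm_f`», the pin) and `u_δ ∘ t = t`; let `d = |Δ|`
and suppose the point groups `A(K)`, `B(K)` are `d`-divisible (e.g. `K` algebraically closed of characteristic prime to `d`).
If at the level `dN` (C) `ē^{Θ_A}(t P, t Q) = ē^{Θ_B}(P, Q)^d` and (D) `ē^{Θ_A}(u_δ P, u_δ Q) = ē^{Θ_A}(P, Q)` hold, then at
the level `N`: **`ē_N^{Θ_A}(t P, Q) = ē_N^{Θ_B}(P, Nm Q)`** — `t` is the level adjoint of `Nm` (weight `1`).  Proof: for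
`Q′^d = Q`, `P̃^d = P`: `ē_{dN}(tP̃, Q) = ē_{dN}(tP̃, Q′)^d = ∏_δ ē_{dN}(tP̃, u_δ Q′) = ē_{dN}(tP̃, t Nm Q′) = ē_{dN}(P̃, Nm Q′)^d
= ē_{dN}(P̃, Nm Q)`, and Lang's change of level on both ends.
[cite: LangeRodriguez2022, §3.5.1 Prop. 3.5.1 and Cor. 3.5.2 (p. 65); §3.2.1 eq. (3.3) (pp. 46–47)]
[cite: Lang1983AbelianVarieties, Ch. VII §2 Prop. 3 and Prop. 5] [cite: MumfordAV1970, §20 (property (3) of e_n, p. 186)] -/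
theorem weilPairingLevel_map_eq_map_of_norm_pin (hcard : Fintype.card Δ = d)
    (hpin : Nm ≫ t = ∑ δ, u δ) (hfix : ∀ δ, t ≫ u δ = t)
    (hdivA : Function.Surjective fun R : A.Points K => R ^ d)
    (hdivB : Function.Surjective fun R : B.Points K => R ^ d)
    (hc : ∀ P Q : B.torsionPoints K ((d * N : ℕ) : ℤ),
      A.weilPairingLevel (N := d * N) ΘA ⟨AlgPoints.map t.hom.hom.hom P.1, map_mem_torsionPoints t P.2⟩
          ⟨AlgPoints.map t.hom.hom.hom Q.1, map_mem_torsionPoints t Q.2⟩ =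
        B.weilPairingLevel (N := d * N) ΘB P Q ^ d)
    (hd : ∀ (δ : Δ) (P Q : A.torsionPoints K ((d * N : ℕ) : ℤ)),
      A.weilPairingLevel (N := d * N) ΘA ⟨AlgPoints.map (u δ).hom.hom.hom P.1, map_mem_torsionPoints (u δ) P.2⟩
          ⟨AlgPoints.map (u δ).hom.hom.hom Q.1, map_mem_torsionPoints (u δ) Q.2⟩ =
        A.weilPairingLevel (N := d * N) ΘA P Q)
    (P : B.torsionPoints K N) (Q : A.torsionPoints K N) :
    A.weilPairingLevel ΘA ⟨AlgPoints.map t.hom.hom.hom P.1, map_mem_torsionPoints t P.2⟩ Q =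
      B.weilPairingLevel ΘB P ⟨AlgPoints.map Nm.hom.hom.hom Q.1, map_mem_torsionPoints Nm Q.2⟩ := by
  classical
  -- `d`-th roots `P̃` of `P` and `Q′` of `Q`; they are `dN`-torsion
  obtain ⟨P', hP'⟩ := hdivB P.1
  obtain ⟨Q', hQ'⟩ := hdivA Q.1
  have hP'd : P' ^ d = P.1 := hP'
  have hQ'd : Q' ^ d = Q.1 := hQ'
  have hP'mem : P' ∈ B.torsionPoints K ((d * N : ℕ) : ℤ) := by
    rw [mem_torsionPoints_iff, zpow_natCast, pow_mul, hP'd]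
    exact coe_torsionPoints_pow_eq_one P
  have hQ'mem : Q' ∈ A.torsionPoints K ((d * N : ℕ) : ℤ) := by
    rw [mem_torsionPoints_iff, zpow_natCast, pow_mul, hQ'd]
    exact coe_torsionPoints_pow_eq_one Q
  set Pr : B.torsionPoints K ((d * N : ℕ) : ℤ) := ⟨P', hP'mem⟩ with hPr
  set Qr : A.torsionPoints K ((d * N : ℕ) : ℤ) := ⟨Q', hQ'mem⟩ with hQr
  -- the image `t P̃` as a `dN`-torsion point, and `(t P̃)^d = t P`
  set tPr : A.torsionPoints K ((d * N : ℕ) : ℤ) :=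
    ⟨AlgPoints.map t.hom.hom.hom P', map_mem_torsionPoints t hP'mem⟩ with htPr
  have htP : A.torsionPointsPow d tPr = ⟨AlgPoints.map t.hom.hom.hom P.1, map_mem_torsionPoints t P.2⟩ :=
    Subtype.ext (by rw [coe_torsionPointsPow, htPr, ← map_pow_eq, hP'd])
  have hPow : B.torsionPointsPow d Pr = P := Subtype.ext hP'd
  -- change of level on the left: `ē_N(tP, Q) = ē_{dN}(tP̃, Q)`
  have eL : A.weilPairingLevel ΘA ⟨AlgPoints.map t.hom.hom.hom P.1, map_mem_torsionPoints t P.2⟩ Q =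
      A.weilPairingLevel (N := d * N) ΘA tPr (A.torsionPointsOfDvd d Q) := by
    rw [← htP, A.weilPairingLevel_level_mul ΘA tPr Q]
  -- change of level on the right: `ē_N(P, Nm Q) = ē_{dN}(P̃, Nm Q)`
  have eR : B.weilPairingLevel ΘB P ⟨AlgPoints.map Nm.hom.hom.hom Q.1, map_mem_torsionPoints Nm Q.2⟩ =
      B.weilPairingLevel (N := d * N) ΘB Pr
        (B.torsionPointsOfDvd d ⟨AlgPoints.map Nm.hom.hom.hom Q.1, map_mem_torsionPoints Nm Q.2⟩) := by
    rw [← hPow, B.weilPairingLevel_level_mul ΘB Pr]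
  rw [eL, eR]
  -- `Q = Q′^d` and `Nm Q = (Nm Q′)^d` as `dN`-torsion points
  have hQup : A.torsionPointsOfDvd d Q = Qr ^ d :=
    Subtype.ext (by rw [coe_torsionPointsOfDvd, SubgroupClass.coe_pow, hQr, hQ'd])
  have hNmQup : B.torsionPointsOfDvd d ⟨AlgPoints.map Nm.hom.hom.hom Q.1, map_mem_torsionPoints Nm Q.2⟩ =
      (⟨AlgPoints.map Nm.hom.hom.hom Q', map_mem_torsionPoints Nm hQ'mem⟩ : B.torsionPoints K ((d * N : ℕ) : ℤ)) ^ d :=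
    Subtype.ext (by rw [coe_torsionPointsOfDvd, SubgroupClass.coe_pow, ← map_pow_eq, hQ'd])
  -- `t (Nm Q′) = ∏_δ u_δ Q′`
  have htNm : (⟨AlgPoints.map t.hom.hom.hom (AlgPoints.map Nm.hom.hom.hom Q'),
        map_mem_torsionPoints t (map_mem_torsionPoints Nm hQ'mem)⟩ : A.torsionPoints K ((d * N : ℕ) : ℤ)) =
      ∏ δ, (⟨AlgPoints.map (u δ).hom.hom.hom Q', map_mem_torsionPoints (u δ) hQ'mem⟩ :
        A.torsionPoints K ((d * N : ℕ) : ℤ)) := by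
    apply Subtype.ext
    rw [SubmonoidClass.coe_finsetProd]
    change AlgPoints.map t.hom.hom.hom (AlgPoints.map Nm.hom.hom.hom Q') = ∏ δ, AlgPoints.map (u δ).hom.hom.hom Q'
    rw [← map_hom_comp_apply, hpin, map_hom_sum_apply]
  -- `u_δ (t P̃) = t P̃`
  have hufix : ∀ δ, (⟨AlgPoints.map (u δ).hom.hom.hom tPr.1, map_mem_torsionPoints (u δ) tPr.2⟩ :
      A.torsionPoints K ((d * N : ℕ) : ℤ)) = tPr := fun δ => by
    apply Subtype.ext
    change AlgPoints.map (u δ).hom.hom.hom (AlgPoints.map t.hom.hom.hom P') = AlgPoints.map t.hom.hom.hom P'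
    rw [← map_hom_comp_apply, hfix]
  -- `ē_{dN}(tP̃, Q′^d) = ē_{dN}(tP̃, Q′)^d = ∏_δ ē_{dN}(tP̃, u_δ Q′) = ē_{dN}(tP̃, t Nm Q′)`
  have e1 : A.weilPairingLevel (N := d * N) ΘA tPr (Qr ^ d) =
      A.weilPairingLevel (N := d * N) ΘA tPr
        ⟨AlgPoints.map t.hom.hom.hom (AlgPoints.map Nm.hom.hom.hom Q'),
          map_mem_torsionPoints t (map_mem_torsionPoints Nm hQ'mem)⟩ := by
    rw [weilPairingLevel_pow_right, htNm, weilPairingLevel_prod_right]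
    have hδ : ∀ δ ∈ (Finset.univ : Finset Δ), A.weilPairingLevel (N := d * N) ΘA tPr
        ⟨AlgPoints.map (u δ).hom.hom.hom Q', map_mem_torsionPoints (u δ) hQ'mem⟩ =
          A.weilPairingLevel (N := d * N) ΘA tPr Qr := fun δ _ => by
      have h' := hd δ tPr Qr
      rw [hufix δ] at h'
      exact h'
    rw [Finset.prod_congr rfl hδ, Finset.prod_const, Finset.card_univ, hcard]
  -- (C) at `(P̃, Nm Q′)`
  have e2 := hc Pr ⟨AlgPoints.map Nm.hom.hom.hom Q', map_mem_torsionPoints Nm hQ'mem⟩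
  rw [hQup, e1, hNmQup, weilPairingLevel_pow_right]
  exact e2

end NormPin

end AbelianVariety

namespace Jacobian

/-! ## §2 `δ_* ∘ p^* = p^*`: the pinned `t` is fixed by the deck group -/

section Fix

variable {k : Type u} [Field k] {X Y : SchemeOver k} (𝒥X : Jacobian X) (𝒥Y : Jacobian Y)
  {Δ : Type v} [Group Δ] [Fintype Δ] (act : Δ →* Aut X) (p : X ⟶ Y)

/-- **`t ≫ δ_* = t`** for the `t : J_Y → J_X` pinned by `Nm_p ≫ t = Σ_{δ′} δ′_*` of a quotient `p : X → Y = X/Δ` (with a rational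
point on `X`): `Nm_p ≫ t ≫ δ_* = Σ_{δ′} (δ′ δ… )_* = Σ_{δ′} δ′_* = Nm_p ≫ t` by reindexing, and `Nm_p` is right-cancellable
(★ `eq_of_pushforward_comp_eq`).  Print: `σ ∘ f^* = f^*` for `σ ∈ G` («`f^*(J) ⊆ J̃^G`»).
[cite: LangeRodriguez2022, §3.5.1 Prop. 3.5.1 and Cor. 3.5.2 (p. 65)] -/
theorem pushforward_act_comp_pullback_eq (hp : IsSepQuotient (fun δ : Δ => act δ) p) (P₀ : AlgPoints X k)
    (t : 𝒥Y.J ⟶ 𝒥X.J) (ht : 𝒥X.pushforward 𝒥Y p ≫ t = ∑ δ : Δ, 𝒥X.pushforward 𝒥X (act δ).hom) (δ : Δ) :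
    t ≫ 𝒥X.pushforward 𝒥X (act δ).hom = t := by
  refine 𝒥X.eq_of_pushforward_comp_eq 𝒥Y (fun δ : Δ => act δ) p hp P₀ ?_
  rw [← Category.assoc, ht, Preadditive.sum_comp]
  have hre : ∀ δ' : Δ, 𝒥X.pushforward 𝒥X (act δ').hom ≫ 𝒥X.pushforward 𝒥X (act δ).hom =
      𝒥X.pushforward 𝒥X (act (δ * δ')).hom := fun δ' => by
    rw [← pushforward_comp, map_mul]
    rfl
  simp_rw [hre]
  exact Fintype.sum_equiv (Equiv.mulLeft δ) _ _ fun δ' => rfl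

end Fix

/-! ## §3 One Galois cover of complex curves: (C) ∧ (D) ⟹ (A), and (A) ⟹ (C) -/

section Complex

variable {X Y : SchemeOver ℂ}

/-- `[d]` is dominant on a complex abelian variety for `d ≠ 0` (it is an isogeny, ★ `isIsogeny_zsmul_id_of_cast_ne_zero`).
This is ★ `AbelianVariety.isDominant_toSchemeHom_zsmul_of_ne_zero` (`Motives/AbelianVarietyWeilPairingAlgClosure`) at `K = ℂ`,
restated privately only to keep that module out of the import cone. [cite: MumfordAV1970, §6 Proposition p. 64] -/
private theorem isDominant_toSchemeHom_zsmul_complex (A : AbelianVariety ℂ) {d : ℕ} (hd : d ≠ 0) :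
    IsDominant (AbelianVariety.Hom.toSchemeHom ((d : ℤ) • 𝟙 A)) :=
  ⟨(A.isIsogeny_zsmul_id_of_cast_ne_zero (d : ℤ) (by exact_mod_cast hd)).1.1.denseRange⟩

/-- `[dN]` is dominant on a complex abelian variety as soon as `[N]` is and `d ≠ 0` (`[dN] = [d] ≫ [N]`, `[d]` an isogeny).
[cite: MumfordAV1970, §6 Proposition p. 64] -/
theorem isDominant_toSchemeHom_mul_zsmul (A : AbelianVariety ℂ) {d N : ℕ} (hd : d ≠ 0)
    [IsDominant (AbelianVariety.Hom.toSchemeHom ((N : ℤ) • 𝟙 A))] :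
    IsDominant (AbelianVariety.Hom.toSchemeHom (((d * N : ℕ) : ℤ) • 𝟙 A)) := by
  haveI := isDominant_toSchemeHom_zsmul_complex A hd
  rw [A.toSchemeHom_mul_zsmul_id]
  infer_instance

/-- **(C) ∧ (D) ⟹ (A) for a Galois cover of complex curves.**  Binders as in the named fact (F-P2): `p : X → Y = X/Δ` a
Galois cover of smooth projective complex curves (`Δ` finite acting faithfully, `IsSepQuotient`), Jacobians `𝒥X`, `𝒥Y`, divisors
`Θ_X`, `Θ_Y`, `t` pinned by `Nm_p ≫ t = Σ δ_*`, a level `N` with `[N]` dominant.  If at the level `|Δ|·N` (C)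
`ē^{Θ_X}(tP, tQ) = ē^{Θ_Y}(P, Q)^{|Δ|}` ([BirkenhakeLange2004] Lemma 12.3.1 on torsion points) and (D) `ē^{Θ_X}(δ_* P, δ_* Q) = ē^{Θ_X}(P, Q)`
(the deck group acts by isometries) hold, then **`ē_N^{Θ_X}(t P, Q) = ē_N^{Θ_Y}(P, Nm_p Q)`** (§1 with `u_δ = δ_*`, §2, and the
divisibility of complex points ★ `AbelianVariety.pow_surjective_of_isAlgClosed`).  No hypothesis on `Θ_X`, `Θ_Y` is needed here.
[cite: LangeRodriguez2022, §3.2.1 eq. (3.3) and Prop. 3.2.1 (a) (pp. 46–47); §3.5.1 Prop. 3.5.1 (p. 65)]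
[cite: BirkenhakeLange2004, §12.3 Lemma 12.3.1 (p. 372)] -/
theorem weilPairingLevel_pullback_norm_adjoint_of_pullback_pow_of_aut (hX : IsSmoothProjective 1 X)
    (𝒥X : Jacobian X) (𝒥Y : Jacobian Y) (Δ : Type) [Group Δ] [Fintype Δ] (act : Δ →* Aut X)
    (p : X ⟶ Y) (hp : IsSepQuotient (fun δ : Δ => act δ) p)
    (ΘX : CartierDivisor 𝒥X.J.X.left) (ΘY : CartierDivisor 𝒥Y.J.X.left)
    (t : 𝒥Y.J ⟶ 𝒥X.J) (ht : 𝒥X.pushforward 𝒥Y p ≫ t = ∑ δ : Δ, 𝒥X.pushforward 𝒥X (act δ).hom)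
    (N : ℕ) [IsDominant (AbelianVariety.Hom.toSchemeHom ((N : ℤ) • 𝟙 𝒥X.J))]
    [IsDominant (AbelianVariety.Hom.toSchemeHom ((N : ℤ) • 𝟙 𝒥Y.J))]
    [IsDominant (AbelianVariety.Hom.toSchemeHom (((Fintype.card Δ * N : ℕ) : ℤ) • 𝟙 𝒥X.J))]
    [IsDominant (AbelianVariety.Hom.toSchemeHom (((Fintype.card Δ * N : ℕ) : ℤ) • 𝟙 𝒥Y.J))]
    (hc : ∀ P Q : 𝒥Y.J.torsionPoints ℂ ((Fintype.card Δ * N : ℕ) : ℤ),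
      𝒥X.J.weilPairingLevel (N := Fintype.card Δ * N) ΘX
          ⟨AlgPoints.map t.hom.hom.hom P.1, AbelianVariety.map_mem_torsionPoints t P.2⟩
          ⟨AlgPoints.map t.hom.hom.hom Q.1, AbelianVariety.map_mem_torsionPoints t Q.2⟩ =
        𝒥Y.J.weilPairingLevel (N := Fintype.card Δ * N) ΘY P Q ^ Fintype.card Δ)
    (hd : ∀ (δ : Δ) (P Q : 𝒥X.J.torsionPoints ℂ ((Fintype.card Δ * N : ℕ) : ℤ)),
      𝒥X.J.weilPairingLevel (N := Fintype.card Δ * N) ΘX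
          ⟨AlgPoints.map (𝒥X.pushforward 𝒥X (act δ).hom).hom.hom.hom P.1,
            AbelianVariety.map_mem_torsionPoints (𝒥X.pushforward 𝒥X (act δ).hom) P.2⟩
          ⟨AlgPoints.map (𝒥X.pushforward 𝒥X (act δ).hom).hom.hom.hom Q.1,
            AbelianVariety.map_mem_torsionPoints (𝒥X.pushforward 𝒥X (act δ).hom) Q.2⟩ =
        𝒥X.J.weilPairingLevel (N := Fintype.card Δ * N) ΘX P Q)
    (P : 𝒥Y.J.torsionPoints ℂ N) (Q : 𝒥X.J.torsionPoints ℂ N) :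
    𝒥X.J.weilPairingLevel ΘX ⟨AlgPoints.map t.hom.hom.hom P.1, AbelianVariety.map_mem_torsionPoints t P.2⟩ Q =
      𝒥Y.J.weilPairingLevel ΘY P
        ⟨AlgPoints.map (𝒥X.pushforward 𝒥Y p).hom.hom.hom Q.1,
          AbelianVariety.map_mem_torsionPoints (𝒥X.pushforward 𝒥Y p) Q.2⟩ := by
  obtain ⟨P₀⟩ := hX.nonempty_algPoints ℂ
  have hd0 : (Fintype.card Δ : ℂ) ≠ 0 := by exact_mod_cast Fintype.card_ne_zero
  haveI := isDominant_toSchemeHom_zsmul_complex 𝒥X.J (Fintype.card_ne_zero (α := Δ))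
  haveI := isDominant_toSchemeHom_zsmul_complex 𝒥Y.J (Fintype.card_ne_zero (α := Δ))
  exact AbelianVariety.weilPairingLevel_map_eq_map_of_norm_pin ΘX ΘY (𝒥X.pushforward 𝒥Y p) t
    (fun δ : Δ => 𝒥X.pushforward 𝒥X (act δ).hom) rfl ht
    (𝒥X.pushforward_act_comp_pullback_eq 𝒥Y act p hp P₀ t ht)
    (𝒥X.J.pow_surjective_of_isAlgClosed _ hd0) (𝒥Y.J.pow_surjective_of_isAlgClosed _ hd0) hc hd P Q

/-- **(A) ⟹ (C): `ē_N^{Θ_X}(t P, t Q) = ē_N^{Θ_Y}(P, Q)^{|Δ|}`** under the named fact (F-P2), for a Galois cover of smooth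
projective complex curves and principal Riemann theta divisors (binders of the fact): `ē_X(tP, tQ) = ē_Y(P, Nm t Q)` by the fact
at `Q := tQ`, and `t ≫ Nm_p = |Δ| • 𝟙` (★ `comp_pushforward_eq_card_zsmul`, «`Nm_f ∘ f^* = d`»).  This is
«`(f^*)^*Θ̃ ≡ d·Θ`» read on `N`-torsion points. [cite: BirkenhakeLange2004, §12.3 Lemma 12.3.1 (p. 372)]
[cite: LangeRodriguez2022, §3.2.1 Prop. 3.2.1 (a) and eq. (3.3) (pp. 46–47)] -/
theorem weilPairingLevel_map_pullback_eq_pow_card (hFP2 : galoisCover_pullback_isWeilPairingAdjoint_norm)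
    (hX : IsSmoothProjective 1 X) (hY : IsSmoothProjective 1 Y)
    (𝒥X : Jacobian X) (𝒥Y : Jacobian Y) (hdim : 1 ≤ 𝒥Y.J.dim) (Δ : Type) [Group Δ] [Fintype Δ] (act : Δ →* Aut X)
    (hact : Function.Injective act) (p : X ⟶ Y) (hp : IsSepQuotient (fun δ : Δ => act δ) p)
    {ΘX : CartierDivisor 𝒥X.J.X.left} {ΘY : CartierDivisor 𝒥Y.J.X.left}
    (h1 : 𝒥X.IsRiemannThetaDivisor ΘX) (h2 : 𝒥X.J.IsPrincipalPolarizationDivisor ΘX)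
    (h3 : 𝒥Y.IsRiemannThetaDivisor ΘY) (h4 : 𝒥Y.J.IsPrincipalPolarizationDivisor ΘY)
    (t : 𝒥Y.J ⟶ 𝒥X.J) (ht : 𝒥X.pushforward 𝒥Y p ≫ t = ∑ δ : Δ, 𝒥X.pushforward 𝒥X (act δ).hom)
    (N : ℕ) [IsDominant (AbelianVariety.Hom.toSchemeHom ((N : ℤ) • 𝟙 𝒥X.J))]
    [IsDominant (AbelianVariety.Hom.toSchemeHom ((N : ℤ) • 𝟙 𝒥Y.J))] (P Q : 𝒥Y.J.torsionPoints ℂ N) :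
    𝒥X.J.weilPairingLevel ΘX ⟨AlgPoints.map t.hom.hom.hom P.1, AbelianVariety.map_mem_torsionPoints t P.2⟩
        ⟨AlgPoints.map t.hom.hom.hom Q.1, AbelianVariety.map_mem_torsionPoints t Q.2⟩ =
      𝒥Y.J.weilPairingLevel ΘY P Q ^ Fintype.card Δ := by
  obtain ⟨P₀⟩ := hX.nonempty_algPoints ℂ
  have h := hFP2 X Y hX hY 𝒥X 𝒥Y hdim Δ act hact p hp ΘX ΘY h1 h2 h3 h4 t ht N P
    ⟨AlgPoints.map t.hom.hom.hom Q.1, AbelianVariety.map_mem_torsionPoints t Q.2⟩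
  rw [h, ← AbelianVariety.weilPairingLevel_pow_right]
  congr 1
  apply Subtype.ext
  rw [SubgroupClass.coe_pow]
  change AlgPoints.map (𝒥X.pushforward 𝒥Y p).hom.hom.hom (AlgPoints.map t.hom.hom.hom Q.1) = Q.1 ^ Fintype.card Δ
  rw [← AbelianVariety.map_hom_comp_apply, 𝒥X.comp_pushforward_eq_card_zsmul 𝒥Y (fun δ : Δ => act δ) p hp P₀ t ht,
    AbelianVariety.map_hom_natCast_zsmul_apply, AlgPoints.map_apply]
  exact congrArg (fun R => R ^ Fintype.card Δ) (Category.comp_id _)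

end Complex

/-! ## §4 The equivalence `(F-P2) ↔ (C) ∧ (D)` -/

/-- **`Jacobian.galoisCover_pullback_isWeilPairingAdjoint_norm ↔ (C) ∧ (D)`.**  The named fact (F-P2) «`p^*` is the
Weil-pairing adjoint of `Nm_p` for the canonical principal polarisations of a Galois cover of complex curves»
([LangeRodriguez2022] (3.3), [Lange2023AbelianVarietiesComplex] (4.9)) is EQUIVALENT to the conjunction of
(C) «`ē_N^{Θ_X}(p^* P, p^* Q) = ē_N^{Θ_Y}(P, Q)^{|Δ|}`» for every such cover — `(f^*)^*Θ̃ ≡ d·Θ` on torsion points,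
[BirkenhakeLange2004] Lemma 12.3.1 — and (D) «`ē_N^{Θ}(Nm_e P, Nm_e Q) = ē_N^{Θ}(P, Q)`» for every automorphism `e` of a smooth
projective complex curve `X` with `dim J_X ≥ 1` and every principal Riemann theta divisor `Θ` of `J_X` — automorphisms of the curve
are isometries of the canonical polarisation, [Lange2023AbelianVarietiesComplex] Prop. 4.1.2 (the polarisation is the intersection
form).  (⇒): ★ `weilPairingLevel_map_pullback_eq_pow_card` and ★ `weilPairingLevel_pushforward_iso_eq`; (⇐): §3, with
`dim J_X ≥ dim J_Y ≥ 1` from `t ≫ Nm_p = |Δ| • 𝟙` (★ `AbelianVariety.dim_le_of_comp_eq_nsmul_id`); the levels `|Δ|·N` are dominant by ★ `isIsogeny_zsmul_id_of_cast_ne_zero`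
(cf. ★ `AbelianVariety.isDominant_toSchemeHom_zsmul_of_ne_zero`).
[cite: LangeRodriguez2022, §3.2.1 eq. (3.3), Prop. 3.2.1 (a) (pp. 46–47); §3.5.1 Prop. 3.5.1 (p. 65)]
[cite: BirkenhakeLange2004, §12.3 Lemma 12.3.1 (p. 372)] [cite: Lange2023AbelianVarietiesComplex, §4.1.2 Prop. 4.1.2 and §4.5.2 eq. (4.9)] -/
theorem galoisCover_pullback_isWeilPairingAdjoint_norm_iff :
    galoisCover_pullback_isWeilPairingAdjoint_norm ↔
      ((∀ (X Y : SchemeOver ℂ), IsSmoothProjective 1 X → IsSmoothProjective 1 Y →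
        ∀ (𝒥X : Jacobian X) (𝒥Y : Jacobian Y), 1 ≤ 𝒥Y.J.dim →
        ∀ (Δ : Type) [Group Δ] [Fintype Δ] (act : Δ →* Aut X), Function.Injective act →
        ∀ (p : X ⟶ Y), IsSepQuotient (fun δ : Δ => act δ) p →
        ∀ (ΘX : CartierDivisor 𝒥X.J.X.left) (ΘY : CartierDivisor 𝒥Y.J.X.left),
          𝒥X.IsRiemannThetaDivisor ΘX → 𝒥X.J.IsPrincipalPolarizationDivisor ΘX →
          𝒥Y.IsRiemannThetaDivisor ΘY → 𝒥Y.J.IsPrincipalPolarizationDivisor ΘY →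
        ∀ (t : 𝒥Y.J ⟶ 𝒥X.J), 𝒥X.pushforward 𝒥Y p ≫ t = ∑ δ : Δ, 𝒥X.pushforward 𝒥X (act δ).hom →
        ∀ (N : ℕ) [IsDominant (AbelianVariety.Hom.toSchemeHom ((N : ℤ) • 𝟙 𝒥X.J))]
          [IsDominant (AbelianVariety.Hom.toSchemeHom ((N : ℤ) • 𝟙 𝒥Y.J))]
          (P Q : 𝒥Y.J.torsionPoints ℂ N),
          𝒥X.J.weilPairingLevel ΘX ⟨AlgPoints.map t.hom.hom.hom P.1, AbelianVariety.map_mem_torsionPoints t P.2⟩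
              ⟨AlgPoints.map t.hom.hom.hom Q.1, AbelianVariety.map_mem_torsionPoints t Q.2⟩ =
            𝒥Y.J.weilPairingLevel ΘY P Q ^ Fintype.card Δ) ∧
      (∀ (X : SchemeOver ℂ), IsSmoothProjective 1 X → ∀ (𝒥X : Jacobian X), 1 ≤ 𝒥X.J.dim →
        ∀ (e : X ≅ X) (Θ : CartierDivisor 𝒥X.J.X.left),
          𝒥X.IsRiemannThetaDivisor Θ → 𝒥X.J.IsPrincipalPolarizationDivisor Θ →
        ∀ (N : ℕ) [IsDominant (AbelianVariety.Hom.toSchemeHom ((N : ℤ) • 𝟙 𝒥X.J))] (P Q : 𝒥X.J.torsionPoints ℂ N),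
          𝒥X.J.weilPairingLevel Θ
              ⟨AlgPoints.map (𝒥X.pushforward 𝒥X e.hom).hom.hom.hom P.1,
                AbelianVariety.map_mem_torsionPoints (𝒥X.pushforward 𝒥X e.hom) P.2⟩
              ⟨AlgPoints.map (𝒥X.pushforward 𝒥X e.hom).hom.hom.hom Q.1,
                AbelianVariety.map_mem_torsionPoints (𝒥X.pushforward 𝒥X e.hom) Q.2⟩ =
            𝒥X.J.weilPairingLevel Θ P Q)) := by
  constructor
  · intro hFP2
    refine ⟨fun X Y hX hY 𝒥X 𝒥Y hdim Δ _ _ act hact p hp ΘX ΘY h1 h2 h3 h4 t ht N _ _ P Q =>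
        weilPairingLevel_map_pullback_eq_pow_card hFP2 hX hY 𝒥X 𝒥Y hdim Δ act hact p hp h1 h2 h3 h4 t ht N P Q,
      fun X hX 𝒥X hdim e Θ h1 h2 N _ P Q => ?_⟩
    exact weilPairingLevel_pushforward_iso_eq hFP2 hX hX 𝒥X 𝒥X hdim e h1 h2 h1 h2 N P Q
  · rintro ⟨hC, hD⟩ X Y hX hY 𝒥X 𝒥Y hdim Δ _ _ act hact p hp ΘX ΘY h1 h2 h3 h4 t ht N _ _ P Q
    obtain ⟨P₀⟩ := hX.nonempty_algPoints ℂ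
    have hcard : Fintype.card Δ ≠ 0 := Fintype.card_ne_zero
    -- `dim J_X ≥ dim J_Y ≥ 1` from `t ≫ Nm = |Δ| • 𝟙`
    have hdimX : 1 ≤ 𝒥X.J.dim := by
      have htNm := 𝒥X.comp_pushforward_eq_card_zsmul 𝒥Y (fun δ : Δ => act δ) p hp P₀ t ht
      rw [natCast_zsmul] at htNm
      exact hdim.trans (AbelianVariety.dim_le_of_comp_eq_nsmul_id hcard htNm)
    haveI := isDominant_toSchemeHom_mul_zsmul 𝒥X.J (N := N) hcard
    haveI := isDominant_toSchemeHom_mul_zsmul 𝒥Y.J (N := N) hcard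
    exact weilPairingLevel_pullback_norm_adjoint_of_pullback_pow_of_aut hX 𝒥X 𝒥Y Δ act p hp ΘX ΘY t ht N
      (fun P' Q' => hC X Y hX hY 𝒥X 𝒥Y hdim Δ act hact p hp ΘX ΘY h1 h2 h3 h4 t ht _ P' Q')
      (fun δ P' Q' => hD X hX 𝒥X hdimX (act δ) ΘX h1 h2 _ P' Q') P Q

end Jacobian

end Literature.AlgebraicGeometry.Motives

end
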